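import Literature.AlgebraicGeometry.HodgeTheory.BettiHodgeConjectureProductOfSurfaces
import HarnessLib

/-!
# The Hodge classes of `S × T` (surface × threefold) and `HC(S × T)`: `dim_ℚ Hdg²(H⁴(S × T)) = dim_ℚ Hdg²(H⁴(T)) + dim_ℚ Hom_HS(H¹(S), H³(T)(1)) + dim_ℚ Hom_HS(H²(S), H²(T)) + dim_ℚ Hom_HS(H³(S), H¹(T)(−1)) + 1`,
# and `HC(S × T)` as soon as the two odd `Hom` vanish and `dim_ℚ Hom_HS(H²(S), H²(T)) = ρ(S) ρ(T)` — e.g. `q(S) = 0` (K3 surfaces) and no morphism of Hodge structures `H²(S) → H²(T)` beyond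
# `NS(S) ⊗ NS(T)` (Voisin I §11.3.3 Thm. 11.38, Lemma 11.41 p. 286, p. 287; Thm. 11.30, Thm. 6.25; Deligne 2000 §1)

Family `hodge`, lane `lit-hodgefound` (Track 2 foundations library; Layers A1/A4), layer `Literature/AlgebraicGeometry/HodgeTheory`.  THEOREMS ONLY (no definition,
no named fact, no instance; D-0026 net debt `0`).  Sequel of the seat's g27-#9 (`BettiHodgeConjectureProductOfSurfaces`, same template for `S × S'`) and g27-#5 (`HC(S ⊗ T)` for `q(S) = 0`,
`h^{2,0}(T) = 0`).  For a surface `S` and a threefold `T` the fivefold `S × T` has ONE middle codimension, `2`, and `H⁴(S ⊗ T)` has the five Künneth pieces `H⁰ ⊗ H⁴(T)`, `H¹(S) ⊗ H³(T)`,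
`H²(S) ⊗ H²(T)`, `H³(S) ⊗ H¹(T)`, `H⁴(S) ⊗ H⁰` — the outer two pure (`Hdg²(H⁴(T)) ⊗ 1`, a line), the odd two carrying the morphisms `H¹(S) → H³(T)(1)`, `H³(S) → H¹(T)(−1)` (Lemma 11.41), the
middle one the morphisms `H²(S) → H²(T)` (`⊇` the `ρ(S) ρ(T)` rank-one ones through divisor classes).  So `HC(S × T)` holds (with `HC(S)`, `HC(T)`, known in dimension `≤ 3`) whenever the odd
morphisms vanish — automatic for `q(S) = 0` — and `H²(S) → H²(T)` has no transcendental part: this REMOVES g27-#5's hypothesis `h^{2,0}(T) = 0` (there `H²(T)` was pure, forcing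
`Hom_HS(H²(S), H²(T)) = Hdg¹(S)^∨ ⊗ H²(T)`), e.g. a K3 surface times a threefold `T` with `p_g(T)`-type classes in `H²` but no morphism `T(S)_ℚ → H²(T)`.

THE PRINTS.  C. Voisin (2002) [VoisinHodgeI2002] §11.3.3 (held text p0236–p0237 = pp. 285–287): Thm. 11.38, Thm. 11.40, Lemma 11.41, p. 287; Thm. 11.30, §6.1.3 Cor. 6.13, §6.2.3 Thm. 6.25.  P. Deligne
(1971) [DeligneHodgeII1971] 2.1.13–2.1.14.  P. Deligne (2000) [Deligne2000] §1.

THE OBJECTS (all the tree's).  `Hdgᵖ(Hᵏ(X)) = (BettiUniverse.hodge hHD hX k).hodgeClasses p`, `ρ = dim_ℚ Hdg¹(H²)`, `q = h^{1,0}(H¹)`; `HodgeStructure.Hom`, `tateTwist`, `cast`; `HodgeConjectureFor`;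
`[HodgeTensorFacts.{0, 0}]`.

WHAT IS PROVED.
* **`dim_ℚ Hdg²(H⁴(S ⊗ T)) = dim_ℚ Hdg²(H⁴(T)) + dim_ℚ Hom_HS(H¹(S), H³(T)(1)) + dim_ℚ Hom_HS(H²(S), H²(T)) + dim_ℚ Hom_HS(H³(S), H¹(T)(−1)) + 1`** (`BettiUniverse.finrank_hodgeClasses_hodge_four_surface_tensor_threefold`;
  any smooth-projective structure on the product).
* **`HC(S ⊗ T)` when `Hom_HS(H¹(S), H³(T)(1)) = 0`, `Hom_HS(H³(S), H¹(T)(−1)) = 0` and `dim_ℚ Hom_HS(H²(S), H²(T)) ≤ ρ(S) ρ(T)`** (`BettiUniverse.hodgeConjectureFor_surface_tensor_threefold_of_hom`), and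
  **`HC(S ⊗ T)` for `q(S) = 0` and `dim_ℚ Hom_HS(H²(S), H²(T)) ≤ ρ(S) ρ(T)`** (`BettiUniverse.hodgeConjectureFor_surface_tensor_threefold_of_q_zero_of_finrank_hom_le`).

DEVIATIONS / SCOPE.  No converse; `T ⊗ S` (factors swapped) is left to the symmetric bookkeeping; the case of a non-zero transcendental morphism `H²(S) → H²(T)` is not treated.

## References
* [VoisinHodgeI2002] C. Voisin, *Hodge Theory and Complex Algebraic Geometry I* (2002) — §11.3.3 Thm. 11.38, Thm. 11.40, Lemma 11.41 (p. 286), p. 287; Thm. 11.30; §6.1.3 Cor. 6.13; §6.2.3 Thm. 6.25.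
* [DeligneHodgeII1971] P. Deligne, *Théorie de Hodge II*, Publ. Math. IHÉS 40 (1971) — 2.1.13–2.1.14.
* [Deligne2000] P. Deligne, *The Hodge conjecture* (Clay, 2000) — §1.

## Provenance
Lane `lit-hodgefound` (Hodge path, Track 2), prover seat `lit-hodgefound-p29` (generation 27), self-proposed row g27-#11 (sequel of g27-#9).
-/

noncomputable section

open scoped TensorProduct
open CategoryTheory MonoidalCategory Module Finset
open Literature.AlgebraicTopology.SingularHomology
open Literature.Geometry.Kaehler

namespace Literature.AlgebraicGeometry.HodgeTheory

open Literature.AlgebraicGeometry.Motives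
open Literature.AlgebraicGeometry.Motives.HodgeStructure

variable {d : ℕ} {S T : SchemeOver ℂ}

section SurfaceThreefold

variable [HodgeTensorFacts.{0, 0}]

/-- **The five pieces: `dim_ℚ Hdg²(H⁴(S ⊗ T)) = dim_ℚ Hdg²(H⁴(T)) + dim_ℚ Hom_HS(H¹(S), H³(T)(1)) + dim_ℚ Hom_HS(H²(S), H²(T)) + dim_ℚ Hom_HS(H³(S), H¹(T)(−1)) + 1`** for a smooth projective
surface `S` and threefold `T` (any smooth-projective structure on the product): Künneth (Thm. 11.38), the outer pieces `H⁰ ⊗ H⁴(T)`, `H⁴(S) ⊗ H⁰` via g27-#2 (`dim Hdg²(H⁴(S)) = 1`, g27-#9), the inner three by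
Lemma 11.41 (g27-#7). [cite: VoisinHodgeI2002, §11.3.3 Thm. 11.38, Thm. 11.40, Lemma 11.41 (pp. 285–286) and p. 287] [cite: DeligneHodgeII1971, 2.1.13–2.1.14] -/
theorem BettiUniverse.finrank_hodgeClasses_hodge_four_surface_tensor_threefold (hHD : exists_isReal_hodgeModel) (hS : IsSmoothProjective 2 S) (hT : IsSmoothProjective 3 T)
    (hST : IsSmoothProjective d (S ⊗ T)) :
    Module.finrank ℚ ↥((BettiUniverse.hodge hHD hST 4).hodgeClasses 2) =
      Module.finrank ℚ ↥((BettiUniverse.hodge hHD hT 4).hodgeClasses 2) +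
        Module.finrank ℚ (HodgeStructure.Hom (BettiUniverse.hodge hHD hS 1) (((BettiUniverse.hodge hHD hT 3).tateTwist 1).cast (by norm_num))) +
          Module.finrank ℚ (HodgeStructure.Hom (BettiUniverse.hodge hHD hS 2) (BettiUniverse.hodge hHD hT 2)) +
            Module.finrank ℚ (HodgeStructure.Hom (BettiUniverse.hodge hHD hS 3) (((BettiUniverse.hodge hHD hT 1).tateTwist (-1)).cast (by norm_num))) + 1 := by
  have h := BettiUniverse.finrank_hodgeClasses_hodge_tensor_eq_sum' hHD hS hT hST 4 2
  rw [show antidiagonal 4 = {(0, 4), (1, 3), (2, 2), (3, 1), (4, 0)} from by decide, Finset.sum_insert (by decide), Finset.sum_insert (by decide),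
    Finset.sum_insert (by decide), Finset.sum_insert (by decide), Finset.sum_singleton] at h
  have e04 : Module.finrank ℚ ↥(((BettiUniverse.hodge hHD hS 0).tensor (BettiUniverse.hodge hHD hT 4)).hodgeClasses 2) =
      Module.finrank ℚ ↥((BettiUniverse.hodge hHD hT 4).hodgeClasses 2) :=
    BettiUniverse.finrank_hodgeClasses_tensor_hodge_zero_left hHD hS hT 4 2
  have e40 : Module.finrank ℚ ↥(((BettiUniverse.hodge hHD hS 4).tensor (BettiUniverse.hodge hHD hT 0)).hodgeClasses 2) = 1 := by
    rw [BettiUniverse.finrank_hodgeClasses_tensor_hodge_zero_right hHD hS hT 4 2]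
    exact BettiUniverse.finrank_hodgeClasses_hodge_four_surface hHD hS
  have e13 : Module.finrank ℚ ↥(((BettiUniverse.hodge hHD hS 1).tensor (BettiUniverse.hodge hHD hT 3)).hodgeClasses 2) =
      Module.finrank ℚ (HodgeStructure.Hom (BettiUniverse.hodge hHD hS 1) (((BettiUniverse.hodge hHD hT 3).tateTwist 1).cast (by norm_num))) := by
    have e := BettiUniverse.finrank_hodgeClasses_tensor_hodge_eq_finrank_hom_tateTwist hHD hS hT 1 3 (s := 1) (by norm_num)
    rw [show (((1 : ℕ) : ℤ) + 1) = 2 by norm_num] at e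
    exact e
  have e31 : Module.finrank ℚ ↥(((BettiUniverse.hodge hHD hS 3).tensor (BettiUniverse.hodge hHD hT 1)).hodgeClasses 2) =
      Module.finrank ℚ (HodgeStructure.Hom (BettiUniverse.hodge hHD hS 3) (((BettiUniverse.hodge hHD hT 1).tateTwist (-1)).cast (by norm_num))) := by
    have e := BettiUniverse.finrank_hodgeClasses_tensor_hodge_eq_finrank_hom_tateTwist hHD hS hT 3 1 (s := -1) (by norm_num)
    rw [show (((3 : ℕ) : ℤ) + -1) = 2 by norm_num] at e
    exact e
  have e22 : Module.finrank ℚ ↥(((BettiUniverse.hodge hHD hS 2).tensor (BettiUniverse.hodge hHD hT 2)).hodgeClasses 2) =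
      Module.finrank ℚ (HodgeStructure.Hom (BettiUniverse.hodge hHD hS 2) (BettiUniverse.hodge hHD hT 2)) :=
    BettiUniverse.finrank_hodgeClasses_tensor_hodge_eq_finrank_hom hHD hS hT 2
  have h' : Module.finrank ℚ ↥((BettiUniverse.hodge hHD hST 4).hodgeClasses 2) =
      Module.finrank ℚ ↥(((BettiUniverse.hodge hHD hS 0).tensor (BettiUniverse.hodge hHD hT 4)).hodgeClasses 2) +
        (Module.finrank ℚ ↥(((BettiUniverse.hodge hHD hS 1).tensor (BettiUniverse.hodge hHD hT 3)).hodgeClasses 2) +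
          (Module.finrank ℚ ↥(((BettiUniverse.hodge hHD hS 2).tensor (BettiUniverse.hodge hHD hT 2)).hodgeClasses 2) +
            (Module.finrank ℚ ↥(((BettiUniverse.hodge hHD hS 3).tensor (BettiUniverse.hodge hHD hT 1)).hodgeClasses 2) +
              Module.finrank ℚ ↥(((BettiUniverse.hodge hHD hS 4).tensor (BettiUniverse.hodge hHD hT 0)).hodgeClasses 2)))) := h
  rw [h', e04, e13, e22, e31, e40]
  ring

/-- **`HC(S ⊗ T)` for a smooth projective surface `S` and threefold `T` with `Hom_HS(H¹(S), H³(T)(1)) = 0`, `Hom_HS(H³(S), H¹(T)(−1)) = 0` and `dim_ℚ Hom_HS(H²(S), H²(T)) ≤ ρ(S) ρ(T)`** (so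
`= ρ(S) ρ(T)`): the fivefold `S × T` then has no exceptional Hodge classes in its only middle codimension `2`, and `HC(S)`, `HC(T)` hold (dimension `≤ 3`).
[cite: VoisinHodgeI2002, §11.3.3 Lemma 11.41, p. 287, Thm. 11.30 and Thm. 6.25] [cite: Deligne2000, §1] -/
theorem BettiUniverse.hodgeConjectureFor_surface_tensor_threefold_of_hom (hHD : exists_isReal_hodgeModel) (hS : IsSmoothProjective 2 S) (hT : IsSmoothProjective 3 T)
    (hST : IsSmoothProjective 5 (S ⊗ T))
    (h13 : Subsingleton (HodgeStructure.Hom (BettiUniverse.hodge hHD hS 1) (((BettiUniverse.hodge hHD hT 3).tateTwist 1).cast (by norm_num))))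
    (h31 : Subsingleton (HodgeStructure.Hom (BettiUniverse.hodge hHD hS 3) (((BettiUniverse.hodge hHD hT 1).tateTwist (-1)).cast (by norm_num))))
    (h22 : Module.finrank ℚ (HodgeStructure.Hom (BettiUniverse.hodge hHD hS 2) (BettiUniverse.hodge hHD hT 2)) ≤
      Module.finrank ℚ ↥((BettiUniverse.hodge hHD hS 2).hodgeClasses 1) * Module.finrank ℚ ↥((BettiUniverse.hodge hHD hT 2).hodgeClasses 1)) :
    HodgeConjectureFor 5 (S ⊗ T) := by
  refine BettiUniverse.hodgeConjectureFor_tensor_of_finrank_eq_sum_of_two_le hHD hS hT hST (fun P hP2 hP5 ↦ ?_)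
    (hodgeConjectureFor_of_dim_le_three_holds (by norm_num) hS) (hodgeConjectureFor_of_dim_le_three_holds le_rfl hT)
  obtain rfl : P = 2 := by omega
  have h22' := le_antisymm h22 (BettiUniverse.picardNumber_mul_le_finrank_hom_hodge_two hHD hS hT)
  have z13 : Module.finrank ℚ (HodgeStructure.Hom (BettiUniverse.hodge hHD hS 1) (((BettiUniverse.hodge hHD hT 3).tateTwist 1).cast (by norm_num))) = 0 :=
    Module.finrank_zero_of_subsingleton
  have z31 : Module.finrank ℚ (HodgeStructure.Hom (BettiUniverse.hodge hHD hS 3) (((BettiUniverse.hodge hHD hT 1).tateTwist (-1)).cast (by norm_num))) = 0 :=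
    Module.finrank_zero_of_subsingleton
  have hcount := BettiUniverse.finrank_hodgeClasses_hodge_four_surface_tensor_threefold hHD hS hT hST
  rw [z13, z31, h22', add_zero, add_zero] at hcount
  -- the right-hand side `Σ_{a+b=2} dim Hdgᵃ(S) · dim Hdgᵇ(T) = 1 · dim Hdg²(H⁴ T) + ρ(S) ρ(T) + 1 · 1`
  rw [show antidiagonal 2 = {(0, 2), (1, 1), (2, 0)} from by decide, Finset.sum_insert (by decide), Finset.sum_insert (by decide), Finset.sum_singleton]
  haveI := BettiUniverse.finite hS (2 * 0)
  haveI := BettiUniverse.finite hT (2 * 0)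
  have t0 : Module.finrank ℚ ↥((BettiUniverse.hodge hHD hS (2 * 0)).hodgeClasses ((0 : ℕ) : ℤ)) = 1 := by
    have e : (BettiUniverse.hodge hHD hS (2 * 0)).hodgeClasses ((0 : ℕ) : ℤ) = ⊤ := BettiUniverse.hodgeClasses_hodge_zero_eq_top hHD hS
    rw [e, finrank_top]; exact BettiUniverse.finrank_bettiCohomology_zero hS
  have t0' : Module.finrank ℚ ↥((BettiUniverse.hodge hHD hT (2 * 0)).hodgeClasses ((0 : ℕ) : ℤ)) = 1 := by
    have e : (BettiUniverse.hodge hHD hT (2 * 0)).hodgeClasses ((0 : ℕ) : ℤ) = ⊤ := BettiUniverse.hodgeClasses_hodge_zero_eq_top hHD hT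
    rw [e, finrank_top]; exact BettiUniverse.finrank_bettiCohomology_zero hT
  have t2 : Module.finrank ℚ ↥((BettiUniverse.hodge hHD hS (2 * 2)).hodgeClasses ((2 : ℕ) : ℤ)) = 1 := BettiUniverse.finrank_hodgeClasses_hodge_four_surface hHD hS
  show _ = Module.finrank ℚ ↥((BettiUniverse.hodge hHD hS (2 * 0)).hodgeClasses ((0 : ℕ) : ℤ)) * Module.finrank ℚ ↥((BettiUniverse.hodge hHD hT (2 * 2)).hodgeClasses ((2 : ℕ) : ℤ)) +
      (Module.finrank ℚ ↥((BettiUniverse.hodge hHD hS (2 * 1)).hodgeClasses ((1 : ℕ) : ℤ)) * Module.finrank ℚ ↥((BettiUniverse.hodge hHD hT (2 * 1)).hodgeClasses ((1 : ℕ) : ℤ)) +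
        Module.finrank ℚ ↥((BettiUniverse.hodge hHD hS (2 * 2)).hodgeClasses ((2 : ℕ) : ℤ)) * Module.finrank ℚ ↥((BettiUniverse.hodge hHD hT (2 * 0)).hodgeClasses ((0 : ℕ) : ℤ)))
  have hc' : Module.finrank ℚ ↥((BettiUniverse.hodge hHD hST (2 * 2)).hodgeClasses ((2 : ℕ) : ℤ)) =
      Module.finrank ℚ ↥((BettiUniverse.hodge hHD hT (2 * 2)).hodgeClasses ((2 : ℕ) : ℤ)) +
        Module.finrank ℚ ↥((BettiUniverse.hodge hHD hS (2 * 1)).hodgeClasses ((1 : ℕ) : ℤ)) * Module.finrank ℚ ↥((BettiUniverse.hodge hHD hT (2 * 1)).hodgeClasses ((1 : ℕ) : ℤ)) + 1 := hcount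
  rw [t0, t0', t2, Nat.one_mul (Module.finrank ℚ _), Nat.mul_one (1 : ℕ), hc']
  ring

/-- **`HC(S ⊗ T)` for a surface `S` with `q(S) = 0` and ANY smooth projective threefold `T` with `dim_ℚ Hom_HS(H²(S), H²(T)) ≤ ρ(S) ρ(T)`** (no morphism of Hodge structures `H²(S) → H²(T)` beyond
`NS(S) ⊗ NS(T)`; the odd pieces vanish with `H¹(S) = H³(S) = 0`) — e.g. a K3 surface times a threefold `T` admitting no non-zero morphism `T(S)_ℚ → H²(T)`; this removes the hypothesis `h^{2,0}(T) = 0` of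
g27-#5's `HC(S ⊗ T)`. [cite: VoisinHodgeI2002, §11.3.3 Lemma 11.41, p. 287, Thm. 11.30, §6.1.3 Cor. 6.13 and Thm. 6.25] [cite: Deligne2000, §1] -/
theorem BettiUniverse.hodgeConjectureFor_surface_tensor_threefold_of_q_zero_of_finrank_hom_le (hHD : exists_isReal_hodgeModel) (hS : IsSmoothProjective 2 S) (hT : IsSmoothProjective 3 T)
    (hST : IsSmoothProjective 5 (S ⊗ T)) (hq : (BettiUniverse.hodge hHD hS 1).hodgeNumber 1 0 = 0)
    (h22 : Module.finrank ℚ (HodgeStructure.Hom (BettiUniverse.hodge hHD hS 2) (BettiUniverse.hodge hHD hT 2)) ≤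
      Module.finrank ℚ ↥((BettiUniverse.hodge hHD hS 2).hodgeClasses 1) * Module.finrank ℚ ↥((BettiUniverse.hodge hHD hT 2).hodgeClasses 1)) :
    HodgeConjectureFor 5 (S ⊗ T) := by
  haveI := BettiUniverse.finite hS 1
  haveI := BettiUniverse.finite hS 3
  have h1 : Module.finrank ℚ (bettiCohomology S 1) = 0 := (BettiUniverse.finrank_bettiCohomology_one_eq_zero_iff hHD hS).2 hq
  have h3 : Module.finrank ℚ (bettiCohomology S 3) = 0 := by
    rw [BettiUniverse.finrank_bettiCohomology_eq_of_add_eq hS (k := 3) (l := 1) (by norm_num)]; exact h1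
  haveI : Subsingleton (bettiCohomology S 1) := Module.finrank_zero_iff.1 h1
  haveI : Subsingleton (bettiCohomology S 3) := Module.finrank_zero_iff.1 h3
  exact BettiUniverse.hodgeConjectureFor_surface_tensor_threefold_of_hom hHD hS hT hST
    HodgeStructure.Hom.toLinearMap_injective.subsingleton HodgeStructure.Hom.toLinearMap_injective.subsingleton h22

end SurfaceThreefold

end Literature.AlgebraicGeometry.HodgeTheory

end
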